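import Summits.RiemannHypothesis.RiemannHypothesis.Theses.SpectralTrace
import Literature.NumberTheory.LFunctions.WeilExplicitProofs
import Literature.NumberTheory.LFunctions.WeilSmallSupportPositivity
import Literature.NumberTheory.LFunctions.WeilGroundState
import Literature.NumberTheory.LFunctions.WeilArchimedeanPositivityProofs

/-!
# No finite, bounded or infinitely-repeating family realises a window trace

Negative-side support for crux `SpectralTrace.WindowTracePrime2` (stmt-RiemannHypothesis-11196;
cdisprove seat refuter-cdisprove-stmt-RiemannHypothesis-11196-0). For a real family `γ : ι → ℝ`
write `Trace(A)` for the window identity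
`∀ g, IsWeilTest g → tsupport g ⊆ [-A, A] → HasSum (fun i ↦ ĝ(1/2+iγ_i)) (W g)` (kept INLINE as a
hypothesis below; the crux is `∃ ι γ, Trace(log 3)`). Refuted natural strengthenings = necessary
structure of every witness, for every level `A > 0`:

* `WindowTracePrime2.Negative.not_trace_of_finite`: no FINITE family (Bombieri 2000 Thm 12
  coercivity `Re W(g ⋆ g̃) ≥ (N+1)‖g‖₂²` for small support, `weilQuadratic_coercive`, against
  `Σ_{i ≤ N} |ĝ(1/2+iγ_i)|² ≤ N (∫|g|)² ≤ N`); `not_windowTracePrime2_finite` (the crux's window).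
* `finite_abs_le_of_trace`: every witness is LOCALLY FINITE, `{i : |γ_i| ≤ K}` finite for all `K`
  (narrow non-negative bump: `Σ_i |ĝ(γ_i)|² < ∞` but `|ĝ(1/2+iγ)| ≥ cos 1 · ∫ g` for `|γ| ≤ K`);
  hence `not_trace_of_bounded`, `finite_fibre_of_trace` (finite multiplicities).
-/

noncomputable section

open Complex Filter Set MeasureTheory
open scoped Real Topology

namespace Summit.RiemannHypothesis.RiemannHypothesis.Theorems.WindowTracePrime2.Negative

open Literature.NumberTheory.LFunctions
open Summit.RiemannHypothesis.RiemannHypothesis.Theses.SpectralTrace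

/-- `|ĝ(1/2 + iγ)| ≤ ∫ |g|` (the summand is a Fourier transform). -/
theorem norm_weilMellin_line_le (g : ℝ → ℂ) (γ : ℝ) :
    ‖weilMellin g (1 / 2 + (γ : ℂ) * Complex.I)‖ ≤ ∫ t, ‖g t‖ := by
  unfold weilMellin
  refine (norm_integral_le_integral_norm _).trans (le_of_eq ?_)
  congr 1 with t
  have : (1 / 2 + (γ : ℂ) * Complex.I - 1 / 2) * (t : ℂ) = ((γ * t : ℝ) : ℂ) * Complex.I := by
    push_cast; ring
  rw [norm_mul, this, Complex.norm_exp_ofReal_mul_I, mul_one]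

/-- AM–GM on the support: `∫ |g| ≤ a + (∫ |g|²)/2` for a test `g` supported in `[-a, a]`. -/
theorem integral_norm_le_of_tsupport {g : ℝ → ℂ} (hg : IsWeilTest g) {a : ℝ} (ha : 0 ≤ a)
    (hsupp : tsupport g ⊆ Set.Icc (-a) a) :
    ∫ t, ‖g t‖ ≤ a + (∫ t, ‖g t‖ ^ 2) / 2 := by
  have hpt : ∀ t, ‖g t‖ ≤ ((Set.Icc (-a) a).indicator (fun _ => (1 : ℝ)) t + ‖g t‖ ^ 2) / 2 := by
    intro t
    by_cases ht : t ∈ Set.Icc (-a) a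
    · rw [Set.indicator_of_mem ht]
      nlinarith [sq_nonneg (‖g t‖ - 1), norm_nonneg (g t)]
    · have h0 : g t = 0 := image_eq_zero_of_notMem_tsupport fun h => ht (hsupp h)
      simp [h0, Set.indicator_of_notMem ht]
  have hc : Continuous fun t => ‖g t‖ := hg.1.continuous.norm
  have hint1 : Integrable fun t => ‖g t‖ := hc.integrable_of_hasCompactSupport hg.2.norm
  have hcs2 : HasCompactSupport fun t => ‖g t‖ ^ 2 :=
    hg.2.norm.comp_left (g := fun x : ℝ => x ^ 2) (zero_pow two_ne_zero)
  have hint2 : Integrable fun t => ‖g t‖ ^ 2 := (hc.pow 2).integrable_of_hasCompactSupport hcs2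
  have hint0 : Integrable fun t => (Set.Icc (-a) a).indicator (fun _ => (1 : ℝ)) t :=
    (integrable_indicator_iff measurableSet_Icc).2
      (integrableOn_const (by rw [Real.volume_Icc]; exact ENNReal.ofReal_ne_top))
  calc ∫ t, ‖g t‖ ≤ ∫ t, ((Set.Icc (-a) a).indicator (fun _ => (1 : ℝ)) t + ‖g t‖ ^ 2) / 2 :=
        integral_mono hint1 ((hint0.add hint2).div_const 2) hpt
    _ = a + (∫ t, ‖g t‖ ^ 2) / 2 := by
        rw [integral_div, integral_add hint0 hint2, integral_indicator_const _ measurableSet_Icc,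
          Real.volume_real_Icc_of_le (by linarith), smul_eq_mul, mul_one]
        ring

/-- **No finite family realises any window `A > 0`** (refutes the natural strengthening
"finitely many quasi-zeros suffice at level `A`"; equivalently every witness of the crux is an
INFINITE family). Proof: Bombieri's coercivity `Re W(g ⋆ g̃) ≥ (N+1)‖g‖₂²` for tests of small
enough support `[-a, a]` (`weilQuadratic_coercive`, Thm. 12, in tree) against the window identity
for `k = g ⋆ g̃` (`tsupport k ⊆ [-2a, 2a] ⊆ [-A, A]`), whose zero side is
`Σ_{i ≤ N} |ĝ(1/2+iγ_i)|² ≤ N (∫|g|)² ≤ N` when `∫|g|² = 1`, `a ≤ 1/2`. [cite: Bombieri2000Weil, §12 Thm. 12] -/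
theorem not_trace_of_finite {A : ℝ} (hA : 0 < A) {ι : Type} [Finite ι] (γ : ι → ℝ) :
    ¬ (∀ g : ℝ → ℂ, IsWeilTest g → tsupport g ⊆ Set.Icc (-A) A →
      HasSum (fun i => weilMellin g (1 / 2 + (γ i : ℂ) * Complex.I)) (weilFunctional g)) := by
  intro hT
  have := Fintype.ofFinite ι
  set N : ℕ := Fintype.card ι with hN
  obtain ⟨a₀, ha₀, hco⟩ := weilQuadratic_coercive ((N : ℝ) + 1)
  set a : ℝ := min a₀ (min (A / 2) (1 / 2)) with ha_def
  have ha : 0 < a := lt_min ha₀ (lt_min (by linarith) (by norm_num))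
  have haa₀ : a ≤ a₀ := min_le_left _ _
  have haA : a ≤ A / 2 := (min_le_right _ _).trans (min_le_left _ _)
  have ha2 : a ≤ 1 / 2 := (min_le_right _ _).trans (min_le_right _ _)
  obtain ⟨g, hg, hsupp, hnorm⟩ := exists_isWeilTest_sphere ha
  have hk : IsWeilTest (weilConv g (weilReflect g)) := hg.weilConv hg.weilReflect
  have hksupp : tsupport (weilConv g (weilReflect g)) ⊆ Set.Icc (-A) A :=
    (tsupport_weilConv_weilReflect_subset hg.2 hsupp).trans
      (Set.Icc_subset_Icc (by linarith) (by linarith))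
  have hsum := hT _ hk hksupp
  have hQ : weilQuadratic g =
      ∑ i, weilMellin (weilConv g (weilReflect g)) (1 / 2 + (γ i : ℂ) * Complex.I) :=
    hsum.unique (hasSum_fintype _)
  have hre : (weilQuadratic g).re = ∑ i, ‖weilMellin g (1 / 2 + (γ i : ℂ) * Complex.I)‖ ^ 2 := by
    rw [hQ, Complex.re_sum]
    refine Finset.sum_congr rfl fun i _ => ?_
    rw [weilMellin_weilQuadratic_of_re_eq hg (by simp), Complex.ofReal_re, Complex.normSq_eq_norm_sq]
  have hL1 : ∫ t, ‖g t‖ ≤ 1 := by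
    have := integral_norm_le_of_tsupport hg ha.le hsupp
    rw [hnorm] at this
    linarith
  have hterm : ∀ i, ‖weilMellin g (1 / 2 + (γ i : ℂ) * Complex.I)‖ ^ 2 ≤ 1 := fun i => by
    have h1 := (norm_weilMellin_line_le g (γ i)).trans hL1
    have h0 := norm_nonneg (weilMellin g (1 / 2 + (γ i : ℂ) * Complex.I))
    nlinarith
  have hup : (weilQuadratic g).re ≤ N := by
    rw [hre]
    calc ∑ i, ‖weilMellin g (1 / 2 + (γ i : ℂ) * Complex.I)‖ ^ 2
        ≤ ∑ _i : ι, (1 : ℝ) := Finset.sum_le_sum fun i _ => hterm i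
      _ = N := by simp [hN]
  have hlow : ((N : ℝ) + 1) * ∫ t, ‖g t‖ ^ 2 ≤ (weilQuadratic g).re := hco a ha haa₀ g hg hsupp
  rw [hnorm, mul_one] at hlow
  linarith

/-- Every witness of a window trace (any level `A > 0`) is an infinite family. -/
theorem infinite_of_trace {A : ℝ} (hA : 0 < A) {ι : Type} {γ : ι → ℝ}
    (h : (∀ g : ℝ → ℂ, IsWeilTest g → tsupport g ⊆ Set.Icc (-A) A →
        HasSum (fun i => weilMellin g (1 / 2 + (γ i : ℂ) * Complex.I)) (weilFunctional g))) :
    Infinite ι :=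
  not_finite_iff_infinite.1 fun _ => not_trace_of_finite hA γ h

/-- In particular the EMPTY family is no witness (the `∃` of the crux has no junk inhabitant):
`W ≢ 0` on the tests of any window. -/
theorem not_trace_of_isEmpty {A : ℝ} (hA : 0 < A) {ι : Type} [IsEmpty ι] (γ : ι → ℝ) :
    ¬ (∀ g : ℝ → ℂ, IsWeilTest g → tsupport g ⊆ Set.Icc (-A) A →
      HasSum (fun i => weilMellin g (1 / 2 + (γ i : ℂ) * Complex.I)) (weilFunctional g)) :=
  not_trace_of_finite hA γ

/-- The finite-family strengthening of the crux is FALSE. -/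
theorem not_windowTracePrime2_finite :
    ¬ ∃ (ι : Type) (_ : Finite ι) (γ : ι → ℝ), ∀ g : ℝ → ℂ, IsWeilTest g →
      tsupport g ⊆ Set.Icc (-Real.log 3) (Real.log 3) →
        HasSum (fun i => weilMellin g (1 / 2 + (γ i : ℂ) * Complex.I)) (weilFunctional g) := by
  rintro ⟨ι, _, γ, h⟩
  exact not_trace_of_finite (Real.log_pos (by norm_num)) γ h

/-- Lower bound for the Fourier transform of a non-negative bump at low frequencies:
if `|γ|·r_out ≤ 1` then `Re b̂(1/2+iγ) ≥ cos 1 · ∫ b`. -/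
theorem re_weilMellin_bump_ge (b : ContDiffBump (0 : ℝ)) {γ : ℝ} (hγ : |γ| * b.rOut ≤ 1) :
    Real.cos 1 * ∫ t, b t ≤ (weilMellin (fun t => (b t : ℂ)) (1 / 2 + (γ : ℂ) * Complex.I)).re := by
  have hexp : ∀ t : ℝ, (1 / 2 + (γ : ℂ) * Complex.I - 1 / 2) * (t : ℂ) = ((γ * t : ℝ) : ℂ) * Complex.I :=
    fun t => by push_cast; ring
  have hint : Integrable fun t : ℝ =>
      (b t : ℂ) * cexp ((1 / 2 + (γ : ℂ) * Complex.I - 1 / 2) * (t : ℂ)) := by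
    refine Continuous.integrable_of_hasCompactSupport ?_ ?_
    · exact (Complex.continuous_ofReal.comp b.continuous).mul (by fun_prop)
    · exact (b.hasCompactSupport.comp_left Complex.ofReal_zero).mul_right
  have hre : ∀ t : ℝ, ((b t : ℂ) * cexp ((1 / 2 + (γ : ℂ) * Complex.I - 1 / 2) * (t : ℂ))).re =
      b t * Real.cos (γ * t) := by
    intro t
    rw [hexp, Complex.re_ofReal_mul, Complex.exp_ofReal_mul_I_re]
  unfold weilMellin
  rw [← RCLike.re_to_complex, ← integral_re hint]
  simp only [RCLike.re_to_complex, hre]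
  rw [← integral_const_mul]
  refine integral_mono ?_ ?_ fun t => ?_
  · exact (b.continuous.const_mul _).integrable_of_hasCompactSupport b.hasCompactSupport.mul_left
  · exact (b.continuous.mul (by fun_prop)).integrable_of_hasCompactSupport
      b.hasCompactSupport.mul_right
  · show Real.cos 1 * b t ≤ b t * Real.cos (γ * t)
    by_cases ht : t ∈ tsupport b
    · rw [b.tsupport_eq, Metric.mem_closedBall, dist_zero_right, Real.norm_eq_abs] at ht
      have h1 : |γ * t| ≤ 1 := by
        rw [abs_mul]
        calc |γ| * |t| ≤ |γ| * b.rOut := by gcongr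
          _ ≤ 1 := hγ
      have hcos : Real.cos 1 ≤ Real.cos (γ * t) := by
        rw [← Real.cos_abs (γ * t)]
        exact Real.cos_le_cos_of_nonneg_of_le_pi (abs_nonneg _) (by linarith [Real.pi_gt_three]) h1
      nlinarith [b.nonneg (x := t)]
    · rw [image_eq_zero_of_notMem_tsupport ht]
      simp

/-- **LOCAL FINITENESS of every witness**: if `γ` realises some window `A > 0` then only
finitely many `γ_i` lie in any bounded set. (Test the identity on `k = g ⋆ g̃`, `g` a narrow
non-negative bump: `Σ_i |ĝ(1/2+iγ_i)|²` converges, and `|ĝ(1/2+iγ)| ≥ cos 1 · ∫ g > 0` for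
`|γ| ≤ K`.) Consequences: bounded families, families with a finite accumulation point, and
families repeating one value infinitely often (infinite multiplicity) are all excluded; the
multiplicities `#{i | γ_i = x}` are finite. -/
theorem finite_abs_le_of_trace {A : ℝ} (hA : 0 < A) {ι : Type} {γ : ι → ℝ}
    (h : (∀ g : ℝ → ℂ, IsWeilTest g → tsupport g ⊆ Set.Icc (-A) A →
        HasSum (fun i => weilMellin g (1 / 2 + (γ i : ℂ) * Complex.I)) (weilFunctional g)))
    (K : ℝ) : {i : ι | |γ i| ≤ K}.Finite := by
  -- a bump of radius `a` with `2a ≤ A` and `(|K|+1) a ≤ 1`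
  set a : ℝ := min (A / 2) (1 / (|K| + 1)) with ha_def
  have hK1 : 0 < |K| + 1 := by positivity
  have ha : 0 < a := lt_min (by linarith) (by positivity)
  have haA : a ≤ A / 2 := min_le_left _ _
  have haK : a ≤ 1 / (|K| + 1) := min_le_right _ _
  let b : ContDiffBump (0 : ℝ) := ⟨a / 2, a, by positivity, by linarith⟩
  set g : ℝ → ℂ := fun t => ((b t : ℝ) : ℂ) with hg_def
  have hg : IsWeilTest g :=
    ⟨Complex.ofRealCLM.contDiff.comp b.contDiff, b.hasCompactSupport.comp_left Complex.ofReal_zero⟩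
  have hsupp : tsupport g ⊆ Set.Icc (-a) a := by
    refine (tsupport_comp_subset Complex.ofReal_zero _).trans ?_
    rw [b.tsupport_eq, Real.closedBall_eq_Icc, zero_sub, zero_add]
  have hk : IsWeilTest (weilConv g (weilReflect g)) := hg.weilConv hg.weilReflect
  have hksupp : tsupport (weilConv g (weilReflect g)) ⊆ Set.Icc (-A) A :=
    (tsupport_weilConv_weilReflect_subset hg.2 hsupp).trans
      (Set.Icc_subset_Icc (by linarith) (by linarith))
  have hsum := h _ hk hksupp
  -- the real parts `|ĝ(γ_i)|²` are summable, hence tend to `0` along `cofinite`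
  have hs : Summable fun i => ‖weilMellin g (1 / 2 + (γ i : ℂ) * Complex.I)‖ ^ 2 := by
    refine (Complex.hasSum_re hsum).summable.congr fun i => ?_
    show (weilMellin (weilConv g (weilReflect g)) (1 / 2 + (γ i : ℂ) * Complex.I)).re = _
    rw [weilMellin_weilQuadratic_of_re_eq hg (by simp), Complex.ofReal_re, Complex.normSq_eq_norm_sq]
  set c₀ : ℝ := Real.cos 1 * ∫ t, b t with hc₀
  have hcos : 0 < Real.cos 1 := Real.cos_pos_of_mem_Ioo ⟨by linarith [Real.pi_gt_three],
    by linarith [Real.pi_gt_three]⟩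
  have hc₀pos : 0 < c₀ := mul_pos hcos b.integral_pos
  have hev := hs.tendsto_cofinite_zero.eventually (gt_mem_nhds (sq_pos_of_pos hc₀pos))
  refine (Filter.eventually_cofinite.1 hev).subset fun i hi => ?_
  -- for `|γ_i| ≤ K`: `‖ĝ(γ_i)‖² ≥ c₀²`
  simp only [Set.mem_setOf_eq, not_lt]
  have hγ : |γ i| * b.rOut ≤ 1 := by
    show |γ i| * a ≤ 1
    calc |γ i| * a ≤ (|K| + 1) * (1 / (|K| + 1)) := by
          gcongr
          exact hi.trans ((le_abs_self K).trans (by linarith))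
      _ = 1 := by field_simp
  have hre := re_weilMellin_bump_ge b hγ
  have hnorm : c₀ ≤ ‖weilMellin g (1 / 2 + (γ i : ℂ) * Complex.I)‖ :=
    hre.trans (Complex.re_le_norm _)
  nlinarith

/-- BOUNDED families are excluded (every witness is unbounded). -/
theorem not_trace_of_bounded {A : ℝ} (hA : 0 < A) {ι : Type} {γ : ι → ℝ} {K : ℝ}
    (hK : ∀ i, |γ i| ≤ K) [Infinite ι] :
    ¬ (∀ g : ℝ → ℂ, IsWeilTest g → tsupport g ⊆ Set.Icc (-A) A →
      HasSum (fun i => weilMellin g (1 / 2 + (γ i : ℂ) * Complex.I)) (weilFunctional g)) := fun h =>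
  Set.infinite_univ (α := ι) ((finite_abs_le_of_trace hA h K).subset fun i _ => hK i)

/-- Multiplicities are finite: no value is repeated infinitely often. -/
theorem finite_fibre_of_trace {A : ℝ} (hA : 0 < A) {ι : Type} {γ : ι → ℝ}
    (h : (∀ g : ℝ → ℂ, IsWeilTest g → tsupport g ⊆ Set.Icc (-A) A →
        HasSum (fun i => weilMellin g (1 / 2 + (γ i : ℂ) * Complex.I)) (weilFunctional g)))
    (x : ℝ) : {i : ι | γ i = x}.Finite :=
  (finite_abs_le_of_trace hA h |x|).subset fun i hi => by
    simp only [Set.mem_setOf_eq] at hi ⊢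
    rw [hi]


end Summit.RiemannHypothesis.RiemannHypothesis.Theorems.WindowTracePrime2.Negative

end
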